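import Mathlib
import Summits.Ventures.DiscreteObjects.Mahler.MahlerMeasurePerron
import Summits.Ventures.DiscreteObjects.Mahler.PisotLowerBound

/-!
# McKee–Smyth Lemma 3.8: reduction to a smaller degree when two conjugates have a root-of-unity ratio (venture `DiscreteObjects`, target L)

Cell `pub-namedobj`, seat `pub-namedobj-mahler-g26`. Framing: lottery ticket; floor = certified bounds/negative ranges.

[cite: MckeeSmyth2021, Lemma 3.8] (the Galois-class step in the proof of the weak Dobrowolski bound, Theorem 3.11).
KERNEL FORM (`exists_irreducible_of_lower_degree`): let `f ∈ ℤ[X]` be monic irreducible with `f(0) ≠ 0` and `M(f) > 1`,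
and suppose two distinct complex roots `a ≠ b` of `f` satisfy `a^p = b^p` for some `p ≥ 1`.  Then there is a monic
irreducible `g ∈ ℤ[X]` with `g(0) ≠ 0`, `1 < M(g) ≤ M(f)` and `deg g < deg f`.

Proof (printed idea, kernel route as in `MahlerMeasurePerron`): over the splitting field `K` of `f` call two roots
equivalent when some positive powers coincide (`x^n = y^n`, `n ≥ 1`); `β` = the product of the class of (a lift of) `a`.
Every embedding `τ : K → ℂ` maps that class onto the class of `τ a` among the complex roots, so every conjugate of `β` is
the product of a complex class: there are at most `#classes ≤ d - 1` of them (`a`, `b` share a class), and the product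
of `max(1,|γ|)` over the conjugates is at most the product of `max(1,|α|)` over all roots, i.e. `M(g) ≤ M(f)` for `g` the
minimal polynomial of `β`; choosing `τ` with `|τ a| > 1` (Galois transitivity; `M(f) > 1`) exhibits a conjugate of
modulus `> 1`, so `M(g) > 1`.  REPLICATION; no new mathematics.
-/

namespace Summit.Ventures.DiscreteObjects.Mahler

open Polynomial

/-! ### The relation "some positive powers coincide" (written out; no new definition) -/

/-- Transitivity of `x^n = y^n (some n ≥ 1)`. -/
theorem powRel_trans {R : Type*} [CommMonoid R] {x y z : R} (h1 : ∃ n : ℕ, 0 < n ∧ x ^ n = y ^ n)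
    (h2 : ∃ n : ℕ, 0 < n ∧ y ^ n = z ^ n) : ∃ n : ℕ, 0 < n ∧ x ^ n = z ^ n := by
  obtain ⟨n, hn, h1⟩ := h1
  obtain ⟨m, hm, h2⟩ := h2
  refine ⟨n * m, Nat.mul_pos hn hm, ?_⟩
  rw [pow_mul, h1, ← pow_mul, mul_comm, pow_mul, h2, ← pow_mul, mul_comm]

/-- Symmetry of `x^n = y^n (some n ≥ 1)`. -/
theorem powRel_symm {R : Type*} [Monoid R] {x y : R} (h : ∃ n : ℕ, 0 < n ∧ x ^ n = y ^ n) :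
    ∃ n : ℕ, 0 < n ∧ y ^ n = x ^ n := by
  obtain ⟨n, hn, h⟩ := h
  exact ⟨n, hn, h.symm⟩

/-- The classes of two related elements coincide (as predicates). -/
theorem powRel_iff_of_powRel {R : Type*} [CommMonoid R] {c c' : R} (h : ∃ n : ℕ, 0 < n ∧ c ^ n = c' ^ n) (y : R) :
    (∃ n : ℕ, 0 < n ∧ y ^ n = c ^ n) ↔ (∃ n : ℕ, 0 < n ∧ y ^ n = c' ^ n) :=
  ⟨fun hy => powRel_trans hy h, fun hy => powRel_trans hy (powRel_symm h)⟩

/-- Injective ring homs reflect and preserve the relation. -/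
theorem powRel_map_iff {R S : Type*} [CommRing R] [CommRing S] (τ : R →+* S) (hτ : Function.Injective τ)
    (x y : R) : (∃ n : ℕ, 0 < n ∧ τ x ^ n = τ y ^ n) ↔ (∃ n : ℕ, 0 < n ∧ x ^ n = y ^ n) := by
  constructor
  · rintro ⟨n, hn, h⟩
    exact ⟨n, hn, hτ (by rw [map_pow, map_pow]; exact h)⟩
  · rintro ⟨n, hn, h⟩
    exact ⟨n, hn, by rw [← map_pow, ← map_pow, h]⟩

/-- Related complex numbers have the same norm. -/
theorem norm_eq_of_powRel {x y : ℂ} (h : ∃ n : ℕ, 0 < n ∧ x ^ n = y ^ n) : ‖x‖ = ‖y‖ := by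
  obtain ⟨n, hn, h⟩ := h
  have h' : ‖x‖ ^ n = ‖y‖ ^ n := by rw [← norm_pow, ← norm_pow, h]
  exact (pow_left_inj₀ (norm_nonneg _) (norm_nonneg _) hn.ne').1 h'

/-! ### Multiset inequalities for `h(γ) = max(1, |γ|)` -/

/-- `max(1, |∏ T|) ≤ ∏_T max(1, |γ|)`. -/
theorem max_one_norm_prod_le (T : Multiset ℂ) : max 1 ‖T.prod‖ ≤ (T.map fun γ => max 1 ‖γ‖).prod :=
  max_le (one_le_prod_map_max_one_norm T) (norm_prod_le_prod_map_max T)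

/-- Monotonicity in the multiset: `T ≤ R ⇒ ∏_T max(1,|γ|) ≤ ∏_R max(1,|γ|)`. -/
theorem prod_map_max_le_of_le {T R : Multiset ℂ} (hTR : T ≤ R) :
    (T.map fun γ => max 1 ‖γ‖).prod ≤ (R.map fun γ => max 1 ‖γ‖).prod := by
  obtain ⟨U, rfl⟩ := Multiset.le_iff_exists_add.mp hTR
  rw [Multiset.map_add, Multiset.prod_add]
  have h1 := one_le_prod_map_max_one_norm U
  have h0 : 0 ≤ (T.map fun γ => max 1 ‖γ‖).prod :=
    le_trans zero_le_one (one_le_prod_map_max_one_norm T)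
  nlinarith

/-- The norm of a product of pairwise related complex numbers: `|∏ T| = |c|^{#T}` when every element of `T` is
related to `c`. -/
theorem norm_prod_eq_pow_of_powRel {T : Multiset ℂ} {c : ℂ} (h : ∀ y ∈ T, ∃ n : ℕ, 0 < n ∧ y ^ n = c ^ n) :
    ‖T.prod‖ = ‖c‖ ^ T.card := by
  induction T using Multiset.induction_on with
  | empty => simp
  | cons y T ih =>
    rw [Multiset.prod_cons, norm_mul, Multiset.card_cons, pow_succ,
      ih (fun z hz => h z (Multiset.mem_cons_of_mem hz)), norm_eq_of_powRel (h y (Multiset.mem_cons_self y T)),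
      mul_comm]

/-- Splitting a filter by pairwise-disjoint predicates: `∏ h` over `s.filter (∃ i ∈ Γ, P i ·)` is the product over
`i ∈ Γ` of `∏ h` over `s.filter (P i)`. -/
theorem prod_map_filter_exists_eq {ι : Type*} [DecidableEq ι] (s : Multiset ℂ) (P : ι → ℂ → Prop)
    [∀ i, DecidablePred (P i)] (Γ : Finset ι)
    (hdis : ∀ i ∈ Γ, ∀ j ∈ Γ, i ≠ j → ∀ y ∈ s, ¬ (P i y ∧ P j y)) :
    ((s.filter fun y => ∃ i ∈ Γ, P i y).map fun γ => max 1 ‖γ‖).prod =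
      ∏ i ∈ Γ, ((s.filter (P i)).map fun γ => max 1 ‖γ‖).prod := by
  classical
  induction Γ using Finset.induction_on with
  | empty => simp
  | @insert j Γ hj ih =>
    rw [Finset.prod_insert hj, ← ih (fun i hi i' hi' hne y hy => hdis i (Finset.mem_insert_of_mem hi) i'
      (Finset.mem_insert_of_mem hi') hne y hy)]
    have hsplit : (s.filter fun y => ∃ i ∈ insert j Γ, P i y) =
        s.filter (P j) + s.filter (fun y => ∃ i ∈ Γ, P i y) := by
      have h1 : (s.filter fun y => ∃ i ∈ insert j Γ, P i y) = s.filter (fun y => P j y ∨ ∃ i ∈ Γ, P i y) :=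
        Multiset.filter_congr fun y _ => by simp
      have h2 : s.filter (fun y => P j y ∧ ∃ i ∈ Γ, P i y) = 0 := by
        rw [Multiset.filter_eq_nil]
        rintro y hy ⟨hPj, i, hi, hPi⟩
        exact hdis j (Finset.mem_insert_self j Γ) i (Finset.mem_insert_of_mem hi)
          (fun h => hj (h ▸ hi)) y hy ⟨hPj, hPi⟩
      have h3 := Multiset.filter_add_filter (P j) (fun y => ∃ i ∈ Γ, P i y) s
      rw [h2, add_zero] at h3
      rw [h1, ← h3]
    rw [hsplit, Multiset.map_add, Multiset.prod_add]

/-! ### The reduction lemma -/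

/-- **[MckeeSmyth2021, Lemma 3.8], kernel form.**  If `f ∈ ℤ[X]` is monic irreducible with `f(0) ≠ 0` and `M(f) > 1`,
and two distinct complex roots `a ≠ b` of `f` have `a^n = b^n` for some `n ≥ 1`, then some monic irreducible `g ∈ ℤ[X]`
with `g(0) ≠ 0` has `1 < M(g) ≤ M(f)` and `deg g < deg f`. -/
theorem exists_irreducible_of_lower_degree (f : ℤ[X]) (hmon : f.Monic) (hirr : Irreducible f) (h0 : f.coeff 0 ≠ 0)
    (hM : 1 < intMahlerMeasure f) {a b : ℂ} (ha : a ∈ (f.map (Int.castRingHom ℂ)).roots)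
    (hb : b ∈ (f.map (Int.castRingHom ℂ)).roots) (hab : a ≠ b) (hrel : ∃ n : ℕ, 0 < n ∧ a ^ n = b ^ n) :
    ∃ g : ℤ[X], g.Monic ∧ Irreducible g ∧ g.coeff 0 ≠ 0 ∧ 1 < intMahlerMeasure g ∧
      intMahlerMeasure g ≤ intMahlerMeasure f ∧ g.natDegree < f.natDegree := by
  classical
  -- (0) splitting field, embeddings, roots (as in `MahlerMeasurePerron`)
  have hf0 : f ≠ 0 := hmon.ne_zero
  have hdeg : 0 < f.natDegree :=
    (Monic.natDegree_pos hmon).2 (fun h => hirr.not_isUnit (h ▸ isUnit_one))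
  let fQ : ℚ[X] := f.map (Int.castRingHom ℚ)
  let K := fQ.SplittingField
  haveI : CharZero K := charZero_of_injective_algebraMap (algebraMap ℚ K).injective
  haveI : NumberField K := NumberField.mk
  haveI : Normal ℚ K := Polynomial.SplittingField.instNormal fQ
  let φ₀ : K →ₐ[ℚ] ℂ := IsAlgClosed.lift
  let φ : K →+* ℂ := φ₀.toRingHom
  have hmapK : f.map (algebraMap ℤ K) = fQ.map (algebraMap ℚ K) := by
    show f.map (algebraMap ℤ K) = (f.map (Int.castRingHom ℚ)).map (algebraMap ℚ K)
    rw [Polynomial.map_map]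
    congr 1
  have hfK0 : f.map (algebraMap ℤ K) ≠ 0 := (hmon.map _).ne_zero
  have hsplitK : (f.map (algebraMap ℤ K)).Splits := by
    rw [hmapK]
    exact SplittingField.splits fQ
  set RK := (f.map (algebraMap ℤ K)).roots with hRK
  set RC := (f.map (Int.castRingHom ℂ)).roots with hRC
  have hroots : ∀ τ : K →+* ℂ, RK.map τ = RC := by
    intro τ
    have hPC : f.map (Int.castRingHom ℂ) = (f.map (algebraMap ℤ K)).map τ := by
      rw [Polynomial.map_map]
      congr 1
      exact RingHom.ext_int _ _
    rw [hRC, hPC, hRK]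
    exact roots_map_of_injective_of_card_eq_natDegree τ.injective (splits_iff_card_roots.mp hsplitK)
  have hRCnodup : RC.Nodup := nodup_roots_of_irreducible hirr hdeg
  have hRCcard : RC.card = f.natDegree := by
    rw [hRC, splits_iff_card_roots.1 (IsAlgClosed.splits _),
      natDegree_map_eq_of_injective (Int.castRingHom ℂ).injective_int]
  have hMf : intMahlerMeasure f = (RC.map fun γ => max 1 ‖γ‖).prod := by
    unfold intMahlerMeasure
    rw [mahlerMeasure_eq_leadingCoeff_mul_prod_roots, (hmon.map (Int.castRingHom ℂ)).leadingCoeff, norm_one, one_mul]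
  -- the roots in `K` are nonzero algebraic integers
  have hRKint : ∀ x ∈ RK, IsIntegral ℤ x := by
    intro x hx
    refine ⟨f, hmon, ?_⟩
    have h := (mem_roots hfK0).1 hx
    rwa [IsRoot, eval_map, ← aeval_def] at h
  have hRKne : ∀ x ∈ RK, x ≠ 0 := by
    intro x hx hx0
    have h := (mem_roots hfK0).1 hx
    rw [hx0, IsRoot, eval_map, eval₂_at_zero] at h
    exact h0 ((algebraMap ℤ K).injective_int (by rw [h, map_zero]))
  -- (1) lifts `a', b'` of `a, b`; the class `C` of `a'`; `β = ∏ C`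
  obtain ⟨a', ha', rfl⟩ : ∃ a' ∈ RK, φ a' = a := Multiset.mem_map.mp (by rw [hroots]; exact ha)
  obtain ⟨b', hb', rfl⟩ : ∃ b' ∈ RK, φ b' = b := Multiset.mem_map.mp (by rw [hroots]; exact hb)
  have hrel' : ∃ n : ℕ, 0 < n ∧ a' ^ n = b' ^ n := (powRel_map_iff φ φ.injective a' b').1 hrel
  set C := RK.filter (fun x => ∃ n : ℕ, 0 < n ∧ x ^ n = a' ^ n) with hC
  set β : K := C.prod with hβ
  -- every embedding maps `C` onto the complex class of the image of `a'`
  have hclass : ∀ τ : K →+* ℂ, C.map τ = RC.filter (fun y => ∃ n : ℕ, 0 < n ∧ y ^ n = (τ a') ^ n) := by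
    intro τ
    rw [← hroots τ, Multiset.filter_map, hC]
    congr 1
    refine Multiset.filter_congr fun x _ => ?_
    change _ ↔ ∃ n : ℕ, 0 < n ∧ τ x ^ n = τ a' ^ n
    exact (powRel_map_iff τ τ.injective x a').symm
  have hτβ : ∀ τ : K →+* ℂ, τ β = (RC.filter (fun y => ∃ n : ℕ, 0 < n ∧ y ^ n = (τ a') ^ n)).prod := by
    intro τ
    rw [hβ, map_multiset_prod, hclass]
  -- (2) `g = minpoly_ℤ β`
  have hβint : IsIntegral ℤ β :=
    IsIntegral.multiset_prod (fun x hx => hRKint x (Multiset.mem_of_mem_filter hx))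
  have hβ0 : β ≠ 0 := by
    rw [hβ]
    exact Multiset.prod_ne_zero fun h => hRKne 0 (Multiset.mem_of_mem_filter h) rfl
  set g := minpoly ℤ β with hg
  have hgmon : g.Monic := minpoly.monic hβint
  have hgirr : Irreducible g := minpoly.irreducible hβint
  have hβintQ : IsIntegral ℚ β := hβint.tower_top
  have hgQ : g.map (algebraMap ℤ ℚ) = minpoly ℚ β :=
    (minpoly.isIntegrallyClosed_eq_field_fractions' ℚ hβint).symm
  set gC := g.map (Int.castRingHom ℂ) with hgC
  have hgCeq : gC = (minpoly ℚ β).map (algebraMap ℚ ℂ) := by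
    rw [← hgQ, Polynomial.map_map]
    congr 1
  have hgC0 : gC ≠ 0 := (hgmon.map _).ne_zero
  have hgdegpos : 0 < g.natDegree := minpoly.natDegree_pos hβint
  have hgCnodup : gC.roots.Nodup := nodup_roots_of_irreducible hgirr hgdegpos
  have hgCcard : gC.roots.card = g.natDegree := by
    rw [hgC, splits_iff_card_roots.1 (IsAlgClosed.splits _),
      natDegree_map_eq_of_injective (Int.castRingHom ℂ).injective_int]
  have hMg : intMahlerMeasure g = (gC.roots.map fun γ => max 1 ‖γ‖).prod := by
    unfold intMahlerMeasure
    rw [mahlerMeasure_eq_leadingCoeff_mul_prod_roots, (hgmon.map (Int.castRingHom ℂ)).leadingCoeff, norm_one, one_mul]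
  -- every complex root of `g` is `τ β` for an embedding `τ`
  have hconj : ∀ γ ∈ gC.roots, ∃ τ : K →+* ℂ, τ β = γ := by
    intro γ hγ
    have hmem : γ ∈ (minpoly ℚ β).rootSet ℂ := by
      rw [mem_rootSet]
      refine ⟨minpoly.ne_zero hβintQ, ?_⟩
      have h := (mem_roots hgC0).1 hγ
      rwa [IsRoot, hgCeq, eval_map, ← aeval_def] at h
    rw [← NumberField.Embeddings.range_eval_eq_rootSet_minpoly K ℂ β] at hmem
    exact hmem
  -- and every `τ β` is a complex root of `g`
  have hrootτ : ∀ τ : K →+* ℂ, τ β ∈ gC.roots := by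
    intro τ
    rw [mem_roots hgC0, IsRoot]
    have hgτ : gC = (g.map (algebraMap ℤ K)).map τ := by
      rw [hgC, Polynomial.map_map]
      congr 1
      exact RingHom.ext_int _ _
    rw [hgτ, eval_map, eval₂_hom, eval_map, ← aeval_def, hg, minpoly.aeval, map_zero]
  -- (3) degree: the conjugates are products of complex classes, and there are at most `d - 1` classes
  have himg : gC.roots.toFinset ⊆ (RC.toFinset.image fun c =>
      (RC.filter (fun y => ∃ n : ℕ, 0 < n ∧ y ^ n = c ^ n)).prod) := by
    intro γ hγ
    rw [Multiset.mem_toFinset] at hγ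
    obtain ⟨τ, rfl⟩ := hconj γ hγ
    rw [Finset.mem_image]
    refine ⟨τ a', ?_, (hτβ τ).symm⟩
    rw [Multiset.mem_toFinset, ← hroots τ]
    exact Multiset.mem_map_of_mem τ ha'
  have hclasses : (RC.toFinset.image fun c => RC.filter (fun y => ∃ n : ℕ, 0 < n ∧ y ^ n = c ^ n)) ⊆
      ((RC.toFinset.erase (φ b')).image fun c => RC.filter (fun y => ∃ n : ℕ, 0 < n ∧ y ^ n = c ^ n)) := by
    intro Q hQ
    rw [Finset.mem_image] at hQ ⊢
    obtain ⟨c, hc, rfl⟩ := hQ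
    by_cases hcb : c = φ b'
    · refine ⟨φ a', ?_, ?_⟩
      · rw [Finset.mem_erase, Multiset.mem_toFinset, ← hroots φ]
        exact ⟨fun h => hab h, Multiset.mem_map_of_mem φ ha'⟩
      · rw [hcb]
        exact Multiset.filter_congr fun y _ => powRel_iff_of_powRel hrel y
    · exact ⟨c, Finset.mem_erase.2 ⟨hcb, hc⟩, rfl⟩
  have hdeglt : g.natDegree < f.natDegree := by
    have h1 : g.natDegree = gC.roots.toFinset.card := by
      rw [Multiset.toFinset_card_of_nodup hgCnodup, hgCcard]
    have h2 : gC.roots.toFinset.card ≤ (RC.toFinset.image fun c =>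
        RC.filter (fun y => ∃ n : ℕ, 0 < n ∧ y ^ n = c ^ n)).card := by
      refine (Finset.card_le_card himg).trans ?_
      have he : (RC.toFinset.image fun c =>
          (RC.filter (fun y => ∃ n : ℕ, 0 < n ∧ y ^ n = c ^ n)).prod) =
          (RC.toFinset.image fun c => RC.filter (fun y => ∃ n : ℕ, 0 < n ∧ y ^ n = c ^ n)).image
            Multiset.prod := by
        rw [Finset.image_image]
        rfl
      rw [he]
      exact Finset.card_image_le
    have h3 := (Finset.card_le_card hclasses).trans Finset.card_image_le
    have h4 : (RC.toFinset.erase (φ b')).card = f.natDegree - 1 := by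
      rw [Finset.card_erase_of_mem, Multiset.toFinset_card_of_nodup hRCnodup, hRCcard]
      rw [Multiset.mem_toFinset, ← hroots φ]
      exact Multiset.mem_map_of_mem φ hb'
    omega
  -- (4) `M(g) ≤ M(f)`
  have hMle : intMahlerMeasure g ≤ intMahlerMeasure f := by
    -- a representative `c γ ∈ RC` of the class whose product is the conjugate `γ`
    have hrep : ∀ γ ∈ gC.roots, ∃ c ∈ RC, γ = (RC.filter (fun y => ∃ n : ℕ, 0 < n ∧ y ^ n = c ^ n)).prod := by
      intro γ hγ
      obtain ⟨τ, rfl⟩ := hconj γ hγ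
      refine ⟨τ a', ?_, hτβ τ⟩
      rw [← hroots τ]
      exact Multiset.mem_map_of_mem τ ha'
    choose! c hc hcγ using hrep
    set Γ := gC.roots.toFinset with hΓ
    have hdis : ∀ γ₁ ∈ Γ, ∀ γ₂ ∈ Γ, γ₁ ≠ γ₂ → ∀ y ∈ RC,
        ¬ ((∃ n : ℕ, 0 < n ∧ y ^ n = c γ₁ ^ n) ∧ (∃ n : ℕ, 0 < n ∧ y ^ n = c γ₂ ^ n)) := by
      intro γ₁ h₁ γ₂ h₂ hne y _ hy
      rw [hΓ, Multiset.mem_toFinset] at h₁ h₂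
      have h12 : ∃ n : ℕ, 0 < n ∧ c γ₁ ^ n = c γ₂ ^ n := powRel_trans (powRel_symm hy.1) hy.2
      apply hne
      rw [hcγ γ₁ h₁, hcγ γ₂ h₂]
      exact congrArg Multiset.prod (Multiset.filter_congr fun z _ => powRel_iff_of_powRel h12 z)
    calc intMahlerMeasure g = ∏ γ ∈ Γ, max 1 ‖γ‖ := by
          rw [hMg, Finset.prod_eq_multiset_prod, hΓ, Multiset.toFinset_val, Multiset.dedup_eq_self.2 hgCnodup]
      _ ≤ ∏ γ ∈ Γ, ((RC.filter (fun y => ∃ n : ℕ, 0 < n ∧ y ^ n = c γ ^ n)).map fun z => max 1 ‖z‖).prod := by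
          refine Finset.prod_le_prod (fun γ _ => le_trans zero_le_one (le_max_left _ _)) fun γ hγ => ?_
          rw [hΓ, Multiset.mem_toFinset] at hγ
          conv_lhs => rw [hcγ γ hγ]
          exact max_one_norm_prod_le _
      _ = ((RC.filter fun y => ∃ γ ∈ Γ, ∃ n : ℕ, 0 < n ∧ y ^ n = c γ ^ n).map fun z => max 1 ‖z‖).prod :=
          (prod_map_filter_exists_eq RC (fun γ y => ∃ n : ℕ, 0 < n ∧ y ^ n = c γ ^ n) Γ hdis).symm
      _ ≤ (RC.map fun γ => max 1 ‖γ‖).prod := prod_map_max_le_of_le (Multiset.filter_le _ _)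
      _ = intMahlerMeasure f := hMf.symm
  -- (5) `M(g) > 1`: a conjugate of modulus `> 1` via a root `c` of `f` outside the unit circle and Galois transitivity
  have hMgt : 1 < intMahlerMeasure g := by
    -- a complex root of modulus `> 1`
    have hout : ∃ c ∈ RC, 1 < ‖c‖ := by
      by_contra hall
      push Not at hall
      have h1 : (RC.map fun γ => max 1 ‖γ‖).prod = 1 := by
        refine Multiset.prod_eq_one fun x hx => ?_
        obtain ⟨γ, hγ, rfl⟩ := Multiset.mem_map.mp hx
        exact max_eq_left (hall γ hγ)
      rw [hMf, h1] at hM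
      exact lt_irrefl _ hM
    obtain ⟨c, hc, hc1⟩ := hout
    obtain ⟨c', hc', rfl⟩ : ∃ c' ∈ RK, φ c' = c := Multiset.mem_map.mp (by rw [hroots]; exact hc)
    -- `a'` and `c'` are conjugate over `ℚ`: both have minimal polynomial `fQ`
    have hfQirr : Irreducible fQ :=
      ((hirr.isPrimitive hdeg.ne').irreducible_iff_irreducible_map_fraction_map (K := ℚ)).mp hirr
    have hminf : ∀ x ∈ RK, minpoly ℚ x = fQ := by
      intro x hx
      symm
      refine minpoly.eq_of_irreducible_of_monic hfQirr ?_ (hmon.map _)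
      have h := (mem_roots hfK0).1 hx
      rw [IsRoot, hmapK, eval_map, ← aeval_def] at h
      exact h
    have hconj' : IsConjRoot ℚ c' a' := by
      rw [isConjRoot_def, hminf c' hc', hminf a' ha']
    obtain ⟨σ, hσ⟩ := hconj'.exists_algEquiv
    let τ : K →+* ℂ := φ.comp (σ : K ≃ₐ[ℚ] K).toRingEquiv.toRingHom
    have hτa : τ a' = φ c' := by
      show φ (σ a') = φ c'
      rw [hσ]
    -- the conjugate `τ β` has modulus `|c|^{#class} > 1`
    have hmem := hrootτ τ
    have hnorm : ‖τ β‖ = ‖φ c'‖ ^ (RC.filter (fun y => ∃ n : ℕ, 0 < n ∧ y ^ n = (φ c') ^ n)).card := by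
      rw [hτβ τ, hτa]
      exact norm_prod_eq_pow_of_powRel fun y hy => (Multiset.mem_filter.1 hy).2
    have hcardpos : 0 < (RC.filter (fun y => ∃ n : ℕ, 0 < n ∧ y ^ n = (φ c') ^ n)).card := by
      rw [Multiset.card_pos_iff_exists_mem]
      exact ⟨φ c', Multiset.mem_filter.2 ⟨hc, 1, Nat.one_pos, rfl⟩⟩
    have hgt : 1 < ‖τ β‖ := by
      rw [hnorm]
      exact one_lt_pow₀ hc1 hcardpos.ne'
    have hle : max 1 ‖τ β‖ ≤ intMahlerMeasure g := by
      rw [hMg]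
      have h := prod_map_max_le_of_le (Multiset.singleton_le.2 hmem)
      rwa [Multiset.map_singleton, Multiset.prod_singleton] at h
    exact lt_of_lt_of_le (lt_max_of_lt_right hgt) hle
  -- (6) `g(0) ≠ 0`
  have hg0 : g.coeff 0 ≠ 0 := by
    intro h
    have h1 : (minpoly ℚ β).coeff 0 = 0 := by
      rw [← hgQ, coeff_map, h, map_zero]
    exact minpoly.coeff_zero_ne_zero hβintQ hβ0 h1
  exact ⟨g, hgmon, hgirr, hg0, hMgt, hMle, hdeglt⟩

end Summit.Ventures.DiscreteObjects.Mahler
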